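import Summits.BirchSwinnertonDyer.BirchSwinnertonDyer.Theorems.PrintCf2RubinValueTwoEllipticUnitsTwoVariableMoments
import Summits.BirchSwinnertonDyer.BirchSwinnertonDyer.Theorems.PrintCf2RubinValueTwoEllipticUnitsGlobalUnitsArtin
import Literature.NumberTheory.EllipticCurves.ProfiniteGroupDistributionInduceFromSubgroupSection
import HarnessLib

/-!
# The moments of de Shalit's two-variable measure at the modulus `𝔣_m` with Artin-lift representatives, along a chain with VARYING
# step primes `𝔣_{m+1} = 𝔣_m·𝔩_m` (II.4.14 (38) / II.4.16 p-adic side at `j = 0`, II.4.7 (16)–(17), II.4.10 Step 2)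

Cell `bsd-print-cf2`, width seat `bsd-line-cf2-p1-w8` g11 (piece (H11)); `--supports` the banked S3a item stmt-BirchSwinnertonDyer-24721 (helper,
Theses-free).  THEOREMS ONLY; CONDITIONAL on the published named facts `DeShalit1987.prop24_ii_galoisAction`, `prop24_iii_unit`,
`prop25_i_normRelation` (hypotheses, never asserted).

The sibling `…EllipticUnitsTwoVariableMomentsArtin` (H6b) states the moments of the two-variable measure along a chain `𝔣_{m+1} = 𝔣_m·𝔩` with
ONE fixed step prime `𝔩`; the measure of `…EllipticUnitsTwoVariableMeasureSteps` (II.4.16: the chain must run through every prime of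
`S ∪ {𝔭̄}` infinitely often to exhaust `K(𝔣p^∞)`) needs the same statements along a chain with VARYING step primes `𝔩 : ℕ → primes`.  The
proofs are those of the siblings VERBATIM — the step prime enters only through the one-step compatibility
`pushforward_induceFrom_μ_ellipticUnitsGlobal_eq`:

* `pushforward_induceFrom_μ_ellipticUnitsGlobal_eq_chain_steps` — the `μ_𝔠(𝔣_m) = i_m(e_{𝔣_m}(𝔠))` are compatible under coarsening;
* `integral_twoVariable_eq_sum_section_steps` — `∫_{Γ_K} χ dμ = (χ(g_𝔠) − N𝔠)⁻¹ Σ_{c′} χ(t_{c′}) ∫_{Gal(K̄/K(𝔣_m))} χ d i_𝔓((t_{c′}⁻¹ • e_{𝔣_m}(𝔠))_𝔓)`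
  for ANY section `t`;
* ★★★ `integral_twoVariable_character_pow_succ_artin_steps` —
  **`∫_{Γ_K} χ dμ = (χ(g_𝔠) − N𝔠)⁻¹ · Σ_{c′} χ(g_{𝔞(c′)}⁻¹) · ([S⁰] D^k H_{e_{𝔣_m}(𝔟(c′))_𝔓} − N𝔠 · [S⁰] D^k H_{e_{𝔣_m}(𝔞(c′))_𝔓})`**.

HONEST FRAMING: an assembly of accepted kernel theorems over published named facts; nothing here closes a crux; no summit statement is
proved; BSD is not proved by any of this.

## References
* [deShalit1987] E. de Shalit, *Iwasawa theory of elliptic curves with complex multiplication* (1987), II.4.14 (38) (p. 71–72), II.4.16 (p. 76),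
  II.4.7 (16)–(17) (p. 60), II.4.10 (p. 63–64), II.4.12 (29)↔(31) and (ii) (p. 66–69), II.2.4 (ii) (p. 44), II.2.5 (i) (p. 47), I.3.4 (p. 18).
-/

-- the summit namespace `Summit.BirchSwinnertonDyer.BirchSwinnertonDyer` repeats the problem name by design (D-0017)
set_option linter.dupNamespace false
set_option autoImplicit false

noncomputable section

open scoped Classical nonZeroDivisors
open scoped NumberField
open Field IsDedekindDomain IsDedekindDomain.HeightOneSpectrum ValuativeRel IsLocalRing MvPowerSeries
open Literature.NumberTheory.NumberFields
open Literature.NumberTheory.GaloisRepresentations Literature.NumberTheory.GaloisRepresentations.IsNonarchimedeanLocalField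
  Literature.NumberTheory.GaloisRepresentations.LubinTate Literature.NumberTheory.GaloisRepresentations.ArtinLocalGlobal
  Literature.NumberTheory.PAdicHodge
open Literature.NumberTheory.EllipticCurves Literature.NumberTheory.EllipticCurves.GroupDistribution
open Literature.NumberTheory.ComplexMultiplication.EllipticUnits
open Literature.NumberTheory.LFunctions.AbelianDensity (artinSymbol)
open Summit.BirchSwinnertonDyer.BirchSwinnertonDyer.Theorems.PrintCf2.EllipticUnitsLocal
open Summit.BirchSwinnertonDyer.BirchSwinnertonDyer.Theorems.PrintCf2.EllipticUnitsGlobal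
open Summit.BirchSwinnertonDyer.BirchSwinnertonDyer.Theorems.PrintCf2.EllipticUnitsGlobalCompat

namespace Summit.BirchSwinnertonDyer.BirchSwinnertonDyer.Theorems.PrintCf2.EllipticUnitsTwoVariable

variable {K : Type} [Field K] [NumberField K] {v : HeightOneSpectrum (𝓞 K)}

attribute [local instance] GlobalNormCoherentUnits.instCommMonoid GlobalNormCoherentUnits.galAction
attribute [local instance] ltNormUniformSpace ltNormIsUniformAddGroup rk1 nF nE fintypeResidueField
attribute [local instance] RelNormCoherentUnits.instCommMonoid

variable [NumberField.IsTotallyComplex K]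
  -- the prints and the global frame
  (h24ii : DeShalit1987.prop24_ii_galoisAction) (h24iii : DeShalit1987.prop24_iii_unit) (h25 : DeShalit1987.prop25_i_normRelation)
  (hK : IsImaginaryQuadratic K) (ι : K →+* ℂ)
  -- the moduli: ANY one-prime-step chain `𝔣_{m+1} = 𝔣_m 𝔩_m`, `𝔩_m ∣ 𝔣_m` (`hstep`), all rigid and prime to `v`
  (𝔣 : ℕ → Ideal (𝓞 K)) (hle : ∀ m, 𝔣 (m + 1) ≤ 𝔣 m)
  (h𝔣0 : ∀ m, 𝔣 m ≠ ⊥) (h𝔣1 : ∀ m, 𝔣 m ≠ ⊤) (hv : ∀ m, ¬ 𝔣 m ≤ v.asIdeal) (hw : ∀ (m : ℕ) (u : (𝓞 K)ˣ), (u : 𝓞 K) - 1 ∈ 𝔣 m → u = 1)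
  -- the common local datum at `v`: `π = u·2`, `σ₀`, `ε`, `θ`, `e₂`
  (hq : residueFieldCard (v.adicCompletion K) = 2)
  (h2 : (valuation (v.adicCompletion K)).IsUniformizer ((((2 : ℕ) : 𝒪[v.adicCompletion K]) : v.adicCompletion K)))
  (u : 𝒪[v.adicCompletion K]ˣ)
  {σ₀ : absoluteGaloisGroup (v.adicCompletion K)} (hσ₀ : IsAbsArithFrob σ₀)
  {ε : (maxUnramifiedCompletion (v.adicCompletion K))ˣ}
  (hε : maxUnramifiedCompletion.galAut (v.adicCompletion K) σ₀ (ε : maxUnramifiedCompletion (v.adicCompletion K)) =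
    algebraMap 𝒪[v.adicCompletion K] (maxUnramifiedCompletion (v.adicCompletion K)) (u : 𝒪[v.adicCompletion K]) *
      (ε : maxUnramifiedCompletion (v.adicCompletion K)))
  (θ : CompletedAlgClosure (v.adicCompletion K) →+* ℂ_[2]) (hθc : Continuous θ)
  (hθ1 : ∀ z : CBall (v.adicCompletion K), ‖θ (z : CompletedAlgClosure (v.adicCompletion K))‖ ≤ 1)
  (hθζ : ∀ ζ' : ℂ_[2], (∃ n : ℕ, ζ' ^ 2 ^ n = 1) →
    ∃ ζ : CompletedAlgClosure (v.adicCompletion K), (∃ n : ℕ, ζ ^ 2 ^ n = 1) ∧ θ ζ = ζ')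
  (e₂ : v.adicCompletionIntegers K ≃+* ℤ_[2])
  (hΘe : ∀ a : 𝒪[v.adicCompletion K], (θ.comp ((CBall (v.adicCompletion K)).subtype.comp
      (algebraMap (UnrCoeff (v.adicCompletion K)) (CBall (v.adicCompletion K))))) (intToUnrCoeff (v.adicCompletion K) a) =
    padicIntCast ℂ_[2] (((e₂ : v.adicCompletionIntegers K →+* ℤ_[2]).comp
      (integerEquivAdicCompletionIntegers v).toRingHom) a))
  -- the per-modulus local models: global witnesses `α_m = π^{f_m}`, coefficient fields `E_m ≤ E_{m+1}`, readings `j_m`, cell maps `ψ_m`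
  (α : ℕ → 𝓞 K) (hα0 : ∀ m, α m ≠ 0) (hα𝔣 : ∀ m, α m - 1 ∈ 𝔣 m) (hαw : ∀ m (w : HeightOneSpectrum (𝓞 K)), w ≠ v → α m ∉ w.asIdeal)
  (f : ℕ → ℕ) (hαπ : ∀ m, ((α m : K) : v.adicCompletion K) =
    ((((u : 𝒪[v.adicCompletion K]) * ((2 : ℕ) : 𝒪[v.adicCompletion K]) : 𝒪[v.adicCompletion K]) : v.adicCompletion K)) ^ f m)
  (E : ℕ → IntermediateField (v.adicCompletion K) (AlgebraicClosure (v.adicCompletion K)))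
  [hfd : ∀ m, FiniteDimensional (v.adicCompletion K) (E m)] [hgal : ∀ m, IsGalois (v.adicCompletion K) (E m)]
  (hE : ∀ m, E m ≤ maxUnramified (v.adicCompletion K))
  (hdegE : ∀ (m : ℕ) (w : WeilGroup (v.adicCompletion K)),
    WeilGroup.toAbsGalois (v.adicCompletion K) w ∈ (E m).fixingSubgroup → (f m : ℤ) ∣ WeilGroup.deg w)
  (hEE : ∀ m, E m ≤ E (m + 1))
  (j : ∀ m : ℕ, unitBall (E m) →+* UnrCoeff (v.adicCompletion K))
  (hj : ∀ m, (j m).comp (algebraMap (LTCoeff (v.adicCompletion K)) (unitBall (E m))) =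
    (intToUnrCoeff (v.adicCompletion K)).comp (LTCoeff.of (v.adicCompletion K)).symm.toRingHom)
  (hjC : ∀ m, (algebraMap (UnrCoeff (v.adicCompletion K)) (CBall (v.adicCompletion K))).comp (j m) = unitBallToCBall (E m))
  (hjj : ∀ (m : ℕ) (y : unitBall (E m)), j (m + 1) (inclUnitBall (F := v.adicCompletion K) (hEE m) y) = j m y)
  (ψ : ∀ m n : ℕ, ↥(absRestrictNormalHom (rayClassField K (𝔣 m))).ker ⧸ (rayAdicTower (𝔪 := 𝔣 m) (h𝔣0 m) v).U n → ZMod (2 ^ (n + 1)))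
  (hψ : ∀ (m n : ℕ) (g : ↥(absRestrictNormalHom (rayClassField K (𝔣 m))).ker), g ∈ (rayAdicTower (𝔪 := 𝔣 m) (h𝔣0 m) v).U 0 →
    ψ m n ((rayAdicTower (𝔪 := 𝔣 m) (h𝔣0 m) v).proj n g) =
      PadicInt.toZModPow (n + 1) ((((Units.map (e₂ : v.adicCompletionIntegers K →+* ℤ_[2]).toMonoidHom).comp
        (rayAdicCharacter (h𝔣0 m) (hv m) (hw m)))⁻¹ g : ℤ_[2]ˣ) : ℤ_[2]))
  -- the twists: ideals `𝔠` prime to all `𝔣_m v`, Galois lifts `g_𝔠 ∈ Γ_K` of their Artin symbols on every `K(𝔣_m v^{k+1})`,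
  -- elliptic-unit families at every modulus
  {I : Type*} (idl : I → Ideal (𝓞 K)) (hidl0 : ∀ i, idl i ≠ ⊥) (hidlc : ∀ i m, IsCoprime (idl i) (𝔣 m * v.asIdeal))
  (g : I → absoluteGaloisGroup K)
  (hg : ∀ (i : I) (m k : ℕ), absRestrictNormalHom (rayClassField K (𝔣 m * v.asIdeal ^ (k + 1))) (g i) =
    artinSymbol (galFrob K (rayClassField K (𝔣 m * v.asIdeal ^ (k + 1)))) (idl i))
  (x : ∀ (i : I) (m k : ℕ), rayClassField K (𝔣 m * v.asIdeal ^ (k + 1)))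
  (hx : ∀ (i : I) (m k : ℕ), IsThetaValueOne ι (𝔣 m * v.asIdeal ^ (k + 1)) (idl i)
    (algClosureEmb ι ((x i m k : rayClassField K (𝔣 m * v.asIdeal ^ (k + 1))) : AlgebraicClosure K)))
  [hN : ∀ m n, ((rayAdicTower (𝔪 := 𝔣 m) (h𝔣0 m) v).U n).Normal]
  [hNabs : ∀ m n, ((absRayAdicTower (𝔪' := 𝔣 m) (h𝔣0 m) v).U n).Normal]

set_option maxHeartbeats 1600000 in
include hj hΘe hjj in
/-- **The `μ_𝔠(𝔣_m) = i_m(e_{𝔣_m}(𝔠))` are compatible under coarsening, for EVERY `𝔠`** (`(id)_* i_{m+1}(e_{𝔣_{m+1}}(𝔠)) = i_m(e_{𝔣_m}(𝔠))`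
levelwise on `Γ_K`): `pushforward_induceFrom_μ_ellipticUnitsGlobal_eq` along the chain `𝔣_{m+1} = 𝔣_m𝔩` — the `hcompat` of
`GroupDistribution.integral_eq_of_glue_at`.  GIVEN II.2.4 (iii), II.2.5 (i).
[cite: deShalit1987, II.4.14 Step 1 (p. 71), II.4.12 (ii) (p. 67), III.1.2 Lemma (ii) (p. 89), II.2.5 (i) (p. 47)] -/
theorem pushforward_induceFrom_μ_ellipticUnitsGlobal_eq_chain_steps
    (hstep : ∀ m, ∃ 𝔩 : HeightOneSpectrum (𝓞 K), 𝔣 (m + 1) = 𝔣 m * 𝔩.asIdeal ∧ 𝔩.asIdeal ∣ 𝔣 m) (c : I) (m n : ℕ)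
    (a : absoluteGaloisGroup K ⧸ (absRayAdicTower (𝔪' := 𝔣 m) (h𝔣0 m) v).U n) :
    ((GroupDistribution.induceFrom (Γ := absoluteGaloisGroup K) (fun k ↦ rayAdicTower_U_eq_subgroupOf (𝔪 := 𝔣 (m + 1)) (h𝔣0 (m + 1)) v k)
        (fun b : GlobalNormCoherentUnits (h𝔣0 (m + 1)) v ↦
          localMeasureFamily (h𝔣0 (m + 1)) (hv (m + 1)) (hw (m + 1)) hq h2 u (E (m + 1)) (hE (m + 1)) hσ₀ hε θ hθ1 (j (m + 1))
            (hjC (m + 1)) e₂ (ψ (m + 1)) (hψ (m + 1))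
            (RelNormCoherentUnits.ofGlobalUnits (h𝔣0 (m + 1)) (hv (m + 1)) (hw (m + 1)) (isUniformizer_unit_mul h2 u) (hα0 (m + 1))
              (hα𝔣 (m + 1)) (hαw (m + 1)) (hαπ (m + 1)) (E (m + 1)) (hE (m + 1)) (hdegE (m + 1)) b))
        zero_le_one (fun _ ↦ le_rfl)
        (ellipticUnitsGlobal h24iii h25 hK ι (h𝔣0 (m + 1)) (h𝔣1 (m + 1)) (hv (m + 1)) (hw (m + 1)) (hidl0 c) (hidlc c (m + 1))
          (x c (m + 1)) (hx c (m + 1)))).pushforward (MonoidHom.id (absoluteGaloisGroup K))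
        (SubgroupTower.le_comap_id (fun m ↦ absRayAdicTower (𝔪' := 𝔣 m) (h𝔣0 m) v)
          (fun m n ↦ absRayAdicTower_U_anti (h𝔣0 m) (h𝔣0 (m + 1)) v (hle m) n) m)).μ n a =
      (GroupDistribution.induceFrom (Γ := absoluteGaloisGroup K) (fun k ↦ rayAdicTower_U_eq_subgroupOf (𝔪 := 𝔣 m) (h𝔣0 m) v k)
        (fun b : GlobalNormCoherentUnits (h𝔣0 m) v ↦
          localMeasureFamily (h𝔣0 m) (hv m) (hw m) hq h2 u (E m) (hE m) hσ₀ hε θ hθ1 (j m) (hjC m) e₂ (ψ m) (hψ m)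
            (RelNormCoherentUnits.ofGlobalUnits (h𝔣0 m) (hv m) (hw m) (isUniformizer_unit_mul h2 u) (hα0 m) (hα𝔣 m) (hαw m)
              (hαπ m) (E m) (hE m) (hdegE m) b))
        zero_le_one (fun _ ↦ le_rfl)
        (ellipticUnitsGlobal h24iii h25 hK ι (h𝔣0 m) (h𝔣1 m) (hv m) (hw m) (hidl0 c) (hidlc c m) (x c m) (hx c m))).μ n a := by
  haveI : FiniteDimensional (v.adicCompletion K) (E (m + 1)) := hfd (m + 1)
  haveI : IsGalois (v.adicCompletion K) (E (m + 1)) := hgal (m + 1)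
  have hjj' : (j (m + 1)).comp (inclUnitBall (F := v.adicCompletion K) (hEE m) : unitBall (E m) →+* unitBall (E (m + 1))) = j m :=
    RingHom.ext (hjj m)
  obtain ⟨𝔩, h𝔣succ, hdiv⟩ := hstep m
  exact pushforward_induceFrom_μ_ellipticUnitsGlobal_eq hq h2 u hσ₀ hε θ hθ1 e₂ hΘe (h𝔣0 m) (h𝔣1 m) (hv m) (hw m) (hα0 m) (hα𝔣 m)
    (hαw m) (hαπ m) (E m) (hE m) (hdegE m) (j m) (hj m) (hjC m) (ψ m) (hψ m) (h𝔣0 (m + 1)) (h𝔣1 (m + 1)) (hv (m + 1)) (hw (m + 1))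
    (hα0 (m + 1)) (hα𝔣 (m + 1)) (hαw (m + 1)) (hαπ (m + 1)) (E (m + 1)) (hE (m + 1)) (hdegE (m + 1)) (j (m + 1)) (hj (m + 1))
    (hjC (m + 1)) (ψ (m + 1)) (hψ (m + 1)) h𝔣succ (hle m) hdiv (hEE m) hjj' h24iii h25 hK ι (hidl0 c) (hidlc c m)
    (hidlc c (m + 1)) (x c m) (hx c m) (x c (m + 1)) (hx c (m + 1)) n a

set_option maxHeartbeats 1600000 in
include hj hΘe hjj in
/-- **THE INTEGRALS OF THE TWO-VARIABLE MEASURE AT THE MODULUS `𝔣_m` WITH ANY SYSTEM OF REPRESENTATIVES** (II.4.14 (38) first line, with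
(29)↔(31) and (16)): in the setting of `integral_twoVariable_eq_sum`, for every section `t` of `Γ_K → Γ_K/Gal(K̄/K(𝔣_m v))`,
**`∫_{Γ_K} χ dμ = (χ(g_𝔠) − N𝔠)⁻¹ · Σ_{c′} χ(t_{c′}) · ∫_{Gal(K̄/K(𝔣_m))} χ d i_𝔓((t_{c′}⁻¹ • e_{𝔣_m}(𝔠))_𝔓)`** (the `Gal(K̄/K(𝔣_m))`-equivariance of
`b ↦ i_𝔓(b_𝔓)`, `globalMeasureFamily_μ_smul`, makes every coset term independent of the representative — I.3.4 Lemma (ii)).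
GIVEN II.2.4 (iii), II.2.5 (i). [cite: deShalit1987, II.4.14 (38) (p. 71–72), II.4.7 (16) (p. 60), II.4.12 (29)↔(31) (p. 67–69), I.3.4 Lemma (ii) (p. 18)] -/
theorem integral_twoVariable_eq_sum_section_steps
    (hstep : ∀ m, ∃ 𝔩 : HeightOneSpectrum (𝓞 K), 𝔣 (m + 1) = 𝔣 m * 𝔩.asIdeal ∧ 𝔩.asIdeal ∣ 𝔣 m)
    (μ : GroupDistribution (SubgroupTower.diagonal (fun m ↦ absRayAdicTower (𝔪' := 𝔣 m) (h𝔣0 m) v)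
        (fun m n ↦ absRayAdicTower_U_anti (h𝔣0 m) (h𝔣0 (m + 1)) v (hle m) n)) ℂ_[2]) (c : I)
    (hμ : ∀ (n : ℕ) (b : absoluteGaloisGroup K ⧸ (absRayAdicTower (𝔪' := 𝔣 n) (h𝔣0 n) v).U n),
        (twisting (g c) (Ideal.absNorm (idl c) : ℂ_[2]) μ).μ n b =
        (GroupDistribution.induceFrom (Γ := absoluteGaloisGroup K) (fun k ↦ rayAdicTower_U_eq_subgroupOf (𝔪 := 𝔣 n) (h𝔣0 n) v k)
          (fun b : GlobalNormCoherentUnits (h𝔣0 n) v ↦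
            localMeasureFamily (h𝔣0 n) (hv n) (hw n) hq h2 u (E n) (hE n) hσ₀ hε θ hθ1 (j n) (hjC n) e₂ (ψ n) (hψ n)
              (RelNormCoherentUnits.ofGlobalUnits (h𝔣0 n) (hv n) (hw n) (isUniformizer_unit_mul h2 u) (hα0 n) (hα𝔣 n) (hαw n)
                (hαπ n) (E n) (hE n) (hdegE n) b))
          zero_le_one (fun _ ↦ le_rfl)
          (ellipticUnitsGlobal h24iii h25 hK ι (h𝔣0 n) (h𝔣1 n) (hv n) (hw n) (hidl0 c) (hidlc c n) (x c n) (hx c n))).μ n b)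
    (m : ℕ) (t : absoluteGaloisGroup K ⧸ (absRayAdicTower (𝔪' := 𝔣 m) (h𝔣0 m) v).U 0 → absoluteGaloisGroup K)
    (ht : ∀ c', (absRayAdicTower (𝔪' := 𝔣 m) (h𝔣0 m) v).proj 0 (t c') = c')
    {χ : absoluteGaloisGroup K → ℂ_[2]} (hχc : (absRayAdicTower (𝔪' := 𝔣 m) (h𝔣0 m) v).IsTowerContinuous χ)
    (hχ : ∀ y z, χ (y * z) = χ y * χ z) (h1 : χ 1 = 1) (hne : χ (g c) ≠ (Ideal.absNorm (idl c) : ℂ_[2])) :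
    μ.integral χ = (χ (g c) - (Ideal.absNorm (idl c) : ℂ_[2]))⁻¹ *
      ∑ c' ∈ (absRayAdicTower (𝔪' := 𝔣 m) (h𝔣0 m) v).cells 0, χ (t c') *
        (localMeasureFamily (h𝔣0 m) (hv m) (hw m) hq h2 u (E m) (hE m) hσ₀ hε θ hθ1 (j m) (hjC m) e₂ (ψ m) (hψ m)
          (RelNormCoherentUnits.ofGlobalUnits (h𝔣0 m) (hv m) (hw m) (isUniformizer_unit_mul h2 u) (hα0 m) (hα𝔣 m) (hαw m) (hαπ m)
            (E m) (hE m) (hdegE m)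
            ((t c')⁻¹ • ellipticUnitsGlobal h24iii h25 hK ι (h𝔣0 m) (h𝔣1 m) (hv m) (hw m) (hidl0 c) (hidlc c m) (x c m) (hx c m)))).integral
          (fun y : ↥(absRestrictNormalHom (rayClassField K (𝔣 m))).ker ↦ χ y) :=
  integral_eq_sum_of_glue_induceFrom_of_le_section (p := 2) (Γ := absoluteGaloisGroup K)
    (𝒰' := fun m ↦ absRayAdicTower (𝔪' := 𝔣 m) (h𝔣0 m) v)
    (href := fun m n ↦ absRayAdicTower_U_anti (h𝔣0 m) (h𝔣0 (m + 1)) v (hle m) n) (B' := fun m ↦ GlobalNormCoherentUnits (h𝔣0 m) v)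
    (H' := fun m ↦ (absRestrictNormalHom (rayClassField K (𝔣 m))).ker) (𝒱' := fun m ↦ rayAdicTower (𝔪 := 𝔣 m) (h𝔣0 m) v)
    (fun m k ↦ rayAdicTower_U_eq_subgroupOf (𝔪 := 𝔣 m) (h𝔣0 m) v k)
    (fun m (b : GlobalNormCoherentUnits (h𝔣0 m) v) ↦
      localMeasureFamily (h𝔣0 m) (hv m) (hw m) hq h2 u (E m) (hE m) hσ₀ hε θ hθ1 (j m) (hjC m) e₂ (ψ m) (hψ m)
        (RelNormCoherentUnits.ofGlobalUnits (h𝔣0 m) (hv m) (hw m) (isUniformizer_unit_mul h2 u) (hα0 m) (hα𝔣 m) (hαw m)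
          (hαπ m) (E m) (hE m) (hdegE m) b))
    zero_le_one (fun _ _ ↦ le_rfl)
    (fun m c ↦ ellipticUnitsGlobal h24iii h25 hK ι (h𝔣0 m) (h𝔣1 m) (hv m) (hw m) (hidl0 c) (hidlc c m) (x c m) (hx c m)) g
    (fun c ↦ Ideal.absNorm (idl c)) μ c hμ
    (pushforward_induceFrom_μ_ellipticUnitsGlobal_eq_chain_steps h24iii h25 hK ι 𝔣 hle h𝔣0 h𝔣1 hv hw hq h2 u hσ₀ hε θ
      hθ1 e₂ hΘe α hα0 hα𝔣 hαw f hαπ E hE hdegE hEE j hj hjC hjj ψ hψ idl hidl0 hidlc x hx hstep c)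
    m (absRayAdicTower_U_le_ker (h𝔣0 m) v le_rfl 0) (ker_le_absRayAdicTower_U_zero_of_padicIntEquiv_two (h𝔣0 m) (hv m) (hw m) e₂)
    (fun h b n a ↦ globalMeasureFamily_μ_smul (h𝔣0 m) (hv m) (hw m) hq h2 u (hα0 m) (hα𝔣 m) (hαw m) (hαπ m) (E m) (hE m) (hdegE m)
      hσ₀ hε θ hθ1 (j m) (hj m) (hjC m) e₂ hΘe (ψ m) (hψ m) h b n a)
    t ht hχc hχ h1 hne

set_option maxHeartbeats 1600000 in
include h24ii hj hΘe hjj hθc hθζ hg in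
/-- ★★★ **THE MOMENTS OF THE TWO-VARIABLE MEASURE AT THE MODULUS `𝔣_m` WITH ARTIN-LIFT REPRESENTATIVES** (de Shalit II.4.7 (16)–(17) VERBATIM
with II.4.10 Step 2 and II.4.12 (29)↔(31)): in the setting of `integral_twoVariable_character_pow_succ` (`χ` multiplicative, `χ(1) = 1`, continuous for
the `m`-th tower, `χ(g_𝔠) ≠ N𝔠`, `χ|_{Gal(K̄/K(𝔣_m))} = (e₂κ_v)^{−(k+1)}`), let `c′ ↦ 𝔞(c′) ∈ I` assign to every class `c′` of `Γ_K/Gal(K̄/K(𝔣_m v))` a family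
ideal whose lift `g_{𝔞(c′)}` lies in the class `c′⁻¹`, and `c′ ↦ 𝔟(c′) ∈ I` the product ideals `𝔞(c′)·𝔠`.  Then
**`∫_{Γ_K} χ dμ = (χ(g_𝔠) − N𝔠)⁻¹ · Σ_{c′} χ(g_{𝔞(c′)}⁻¹) · ([S⁰] D^k H_{e_{𝔣_m}(𝔟(c′))_𝔓} − N𝔠 · [S⁰] D^k H_{e_{𝔣_m}(𝔞(c′))_𝔓})`**
(`H_β = Θ(j_m((δ_{E_m} g_β)~) ∘ ϑ)`): `integral_twoVariable_eq_sum_section` with `t_{c′} = g_{𝔞(c′)}⁻¹`, II.2.4 (ii) at the measure level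
(`integral_localMeasureFamily_smul_ellipticUnitsGlobal`) and the moments of the one-`𝔓` family (`integral_character_pow_succ_localMeasureFamily_eq`) —
only the elliptic units `e_{𝔣_m}(𝔟)` themselves enter.  GIVEN II.2.4 (ii)/(iii), II.2.5 (i).
[cite: deShalit1987, II.4.7 (16)–(17) (p. 60), II.4.10 (p. 64), II.4.14 (38) (p. 71–72), II.4.12 (29)↔(31) (p. 67–69), II.2.4 (ii) (p. 44)] -/
theorem integral_twoVariable_character_pow_succ_artin_steps
    (hstep : ∀ m, ∃ 𝔩 : HeightOneSpectrum (𝓞 K), 𝔣 (m + 1) = 𝔣 m * 𝔩.asIdeal ∧ 𝔩.asIdeal ∣ 𝔣 m)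
    (μ : GroupDistribution (SubgroupTower.diagonal (fun m ↦ absRayAdicTower (𝔪' := 𝔣 m) (h𝔣0 m) v)
        (fun m n ↦ absRayAdicTower_U_anti (h𝔣0 m) (h𝔣0 (m + 1)) v (hle m) n)) ℂ_[2]) (c : I)
    (hμ : ∀ (n : ℕ) (b : absoluteGaloisGroup K ⧸ (absRayAdicTower (𝔪' := 𝔣 n) (h𝔣0 n) v).U n),
        (twisting (g c) (Ideal.absNorm (idl c) : ℂ_[2]) μ).μ n b =
        (GroupDistribution.induceFrom (Γ := absoluteGaloisGroup K) (fun k ↦ rayAdicTower_U_eq_subgroupOf (𝔪 := 𝔣 n) (h𝔣0 n) v k)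
          (fun b : GlobalNormCoherentUnits (h𝔣0 n) v ↦
            localMeasureFamily (h𝔣0 n) (hv n) (hw n) hq h2 u (E n) (hE n) hσ₀ hε θ hθ1 (j n) (hjC n) e₂ (ψ n) (hψ n)
              (RelNormCoherentUnits.ofGlobalUnits (h𝔣0 n) (hv n) (hw n) (isUniformizer_unit_mul h2 u) (hα0 n) (hα𝔣 n) (hαw n)
                (hαπ n) (E n) (hE n) (hdegE n) b))
          zero_le_one (fun _ ↦ le_rfl)
          (ellipticUnitsGlobal h24iii h25 hK ι (h𝔣0 n) (h𝔣1 n) (hv n) (hw n) (hidl0 c) (hidlc c n) (x c n) (hx c n))).μ n b)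
    (m k : ℕ) {χ : absoluteGaloisGroup K → ℂ_[2]} (hχc : (absRayAdicTower (𝔪' := 𝔣 m) (h𝔣0 m) v).IsTowerContinuous χ)
    (hχ : ∀ y z, χ (y * z) = χ y * χ z) (h1 : χ 1 = 1) (hne : χ (g c) ≠ (Ideal.absNorm (idl c) : ℂ_[2]))
    (hχG : ∀ y : ↥(absRestrictNormalHom (rayClassField K (𝔣 m))).ker, χ y =
      padicIntCast ℂ_[2] (((((Units.map (e₂ : v.adicCompletionIntegers K →+* ℤ_[2]).toMonoidHom).comp
        (rayAdicCharacter (h𝔣0 m) (hv m) (hw m)))⁻¹) y : ℤ_[2]) ^ (k + 1)))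
    (a : absoluteGaloisGroup K ⧸ (absRayAdicTower (𝔪' := 𝔣 m) (h𝔣0 m) v).U 0 → I)
    (ha : ∀ c', (absRayAdicTower (𝔪' := 𝔣 m) (h𝔣0 m) v).proj 0 (g (a c')) = c'⁻¹)
    (b : absoluteGaloisGroup K ⧸ (absRayAdicTower (𝔪' := 𝔣 m) (h𝔣0 m) v).U 0 → I) (hb : ∀ c', idl (b c') = idl (a c') * idl c) :
    μ.integral χ = (χ (g c) - (Ideal.absNorm (idl c) : ℂ_[2]))⁻¹ *
      ∑ c' ∈ (absRayAdicTower (𝔪' := 𝔣 m) (h𝔣0 m) v).cells 0, χ ((g (a c'))⁻¹) *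
        (PowerSeries.constantCoeff (mahlerD^[k] ((PowerSeries.subst (compSeriesC h2 hσ₀ u hε)
          ((relTildeSeries (isUniformizer_unit_mul h2 u) (E m) hq (hE m) hσ₀
            (LTCoeff.of (v.adicCompletion K) (u : 𝒪[v.adicCompletion K]))
            (RelNormCoherentUnits.ofGlobalUnits (h𝔣0 m) (hv m) (hw m) (isUniformizer_unit_mul h2 u) (hα0 m) (hα𝔣 m) (hαw m)
              (hαπ m) (E m) (hE m) (hdegE m)
              (ellipticUnitsGlobal h24iii h25 hK ι (h𝔣0 m) (h𝔣1 m) (hv m) (hw m) (hidl0 (b c')) (hidlc (b c') m) (x (b c') m)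
                (hx (b c') m)))).map (j m))).map
          (θ.comp ((CBall (v.adicCompletion K)).subtype.comp
            (algebraMap (UnrCoeff (v.adicCompletion K)) (CBall (v.adicCompletion K))))))) -
        (Ideal.absNorm (idl c) : ℂ_[2]) *
          PowerSeries.constantCoeff (mahlerD^[k] ((PowerSeries.subst (compSeriesC h2 hσ₀ u hε)
          ((relTildeSeries (isUniformizer_unit_mul h2 u) (E m) hq (hE m) hσ₀
            (LTCoeff.of (v.adicCompletion K) (u : 𝒪[v.adicCompletion K]))
            (RelNormCoherentUnits.ofGlobalUnits (h𝔣0 m) (hv m) (hw m) (isUniformizer_unit_mul h2 u) (hα0 m) (hα𝔣 m) (hαw m)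
              (hαπ m) (E m) (hE m) (hdegE m)
              (ellipticUnitsGlobal h24iii h25 hK ι (h𝔣0 m) (h𝔣1 m) (hv m) (hw m) (hidl0 (a c')) (hidlc (a c') m) (x (a c') m)
                (hx (a c') m)))).map (j m))).map
          (θ.comp ((CBall (v.adicCompletion K)).subtype.comp
            (algebraMap (UnrCoeff (v.adicCompletion K)) (CBall (v.adicCompletion K)))))))) := by
  have ht : ∀ c', (absRayAdicTower (𝔪' := 𝔣 m) (h𝔣0 m) v).proj 0 (g (a c'))⁻¹ = c' := fun c' ↦ by
    rw [SubgroupTower.proj_inv, ha, inv_inv]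
  rw [integral_twoVariable_eq_sum_section_steps h24iii h25 hK ι 𝔣 hle h𝔣0 h𝔣1 hv hw hq h2 u hσ₀ hε θ hθ1 e₂ hΘe α hα0 hα𝔣
    hαw f hαπ E hE hdegE hEE j hj hjC hjj ψ hψ idl hidl0 hidlc g x hx hstep μ c hμ m (fun c' ↦ (g (a c'))⁻¹) ht hχc hχ h1 hne]
  congr 1
  refine Finset.sum_congr rfl fun c' _ ↦ ?_
  congr 1
  have hfun : (fun y : ↥(absRestrictNormalHom (rayClassField K (𝔣 m))).ker ↦ χ y) = fun y ↦
      padicIntCast ℂ_[2] (((((Units.map (e₂ : v.adicCompletionIntegers K →+* ℤ_[2]).toMonoidHom).comp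
        (rayAdicCharacter (h𝔣0 m) (hv m) (hw m)))⁻¹) y : ℤ_[2]) ^ (k + 1)) := funext hχG
  rw [inv_inv, hfun, integral_localMeasureFamily_smul_ellipticUnitsGlobal h24ii h24iii h25 hK ι (h𝔣0 m) (h𝔣1 m) (hv m) (hw m) hq h2 u
      (hα0 m) (hα𝔣 m) (hαw m) (hαπ m) (E m) (hE m) (hdegE m) hσ₀ hε θ hθ1 (j m) (hjC m) e₂ (ψ m) (hψ m) (hidl0 (a c'))
      (hidlc (a c') m) (hidl0 c) (hidlc c m) (hidl0 (b c')) (hidlc (b c') m) (hb c') (x (a c') m) (hx (a c') m) (x c m) (hx c m)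
      (x (b c') m) (hx (b c') m) (g (a c')) (hg (a c') m)
      (SubgroupTower.isTowerContinuous_padicIntCast_character_pow _ (mem_rayAdicTower_iff_inv (h𝔣0 m) (h𝔣0 m) (hv m) (hw m) e₂ le_rfl (hv m))
        (k + 1)),
    integral_character_pow_succ_localMeasureFamily_eq (h𝔣0 m) (hv m) (hw m) hq h2 u (E m) (hE m) hσ₀ hε θ hθc hθ1 hθζ (j m) (hj m)
      (hjC m) e₂ hΘe (ψ m) (hψ m) _ k,
    integral_character_pow_succ_localMeasureFamily_eq (h𝔣0 m) (hv m) (hw m) hq h2 u (E m) (hE m) hσ₀ hε θ hθc hθ1 hθζ (j m) (hj m)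
      (hjC m) e₂ hΘe (ψ m) (hψ m) _ k]

end Summit.BirchSwinnertonDyer.BirchSwinnertonDyer.Theorems.PrintCf2.EllipticUnitsTwoVariable

end
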